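import Mathlib
import Literature.Computability.AlgebraicComplexity.PermanentIrreducible
import Literature.Computability.AlgebraicComplexity.StandardFamiliesProofs

/-!
# Crux `DivisionGap.PerCofactorDegreeReduction` (stmt-ValiantsHypothesis-15046), line `Sketch` —
# stub `stub_relationComponents`: weighted components of a relation modulo the permanent are
# again relations

**Theorem (`stub_relationComponents`).** Let `U, U' ∈ ℝ[x_ij]` (`n × n` variables) be forms of
degrees `e, e'`, and let `R ∈ ℝ[y₀, y₁]` satisfy `per_n ∣ R(U, U')`.  Then `per_n ∣ R_D(U, U')` for
every `D`, where `R_D` is the weighted homogeneous component of `R` of weight `D` for the weights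
`(e, e')` on `(y₀, y₁)`.

## Proof

* Substituting forms is graded: if every `f i` is a form of degree `w i`, the monomial `c · y^m`
  goes to `c · ∏ (f i)^(m i)`, a form of degree `Σ m i · w i = weight w m`
  (`isHomogeneous_aeval_monomial`); hence, by linearity (induction over monomials),
  `homogeneousComponent D (R(f)) = (weightedHomogeneousComponent w D R)(f)`
  (`homogeneousComponent_aeval`).
* Principal ideals of forms are homogeneous: for a form `P` of degree `k`, writing `Q = Σ_i Q_i`
  in homogeneous components (`sum_homogeneousComponent`),
  `homogeneousComponent D (P · Q) = Σ_i [D = k + i] · P · Q_i` is a multiple of `P`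
  (`dvd_homogeneousComponent_mul`).
* `per_n` is a form of degree `n` (`perPoly_isHomogeneous`), so `R(U, U') = per_n · Q` gives
  `R_D(U, U') = homogeneousComponent D (per_n · Q)`, a multiple of `per_n`.
-/

noncomputable section

-- `Summit.ValiantsHypothesis.ValiantsHypothesis.…` is the tree's mandated single-conjunct layout
-- (Problem = Summit), so the duplicated namespace component is intended.
set_option linter.dupNamespace false

namespace Summit.ValiantsHypothesis.ValiantsHypothesis.Theorems.DivisionGap.PerCofactorDegreeReduction.RelationComponents

open MvPolynomial Literature.Computability.AlgebraicComplexity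
open scoped BigOperators

/-! ### Substituting forms is a graded homomorphism -/

/-- Substituting forms of degrees `w i` for the variables sends the monomial `c · y^m` to a form of
degree `weight w m = Σ i, m i · w i`. [folklore] -/
theorem isHomogeneous_aeval_monomial {σ τ R : Type*} [CommSemiring R] (w : σ → ℕ)
    {f : σ → MvPolynomial τ R} (hf : ∀ i, (f i).IsHomogeneous (w i)) (m : σ →₀ ℕ) (c : R) :
    (aeval f (monomial m c)).IsHomogeneous (Finsupp.weight w m) := by
  rw [aeval_monomial, algebraMap_eq, Finsupp.weight_apply, Finsupp.prod, Finsupp.sum]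
  refine (IsHomogeneous.prod m.support (fun i => f i ^ m i) (fun i => m i • w i)
    fun i _ => ?_).C_mul c
  rw [smul_eq_mul, mul_comm]
  exact (hf i).pow (m i)

/-- Substituting forms of degrees `w i` for the variables intertwines the weighted homogeneous
components (weights `w`) with the homogeneous components. [folklore] -/
theorem homogeneousComponent_aeval {σ τ R : Type*} [CommSemiring R] (w : σ → ℕ)
    {f : σ → MvPolynomial τ R} (hf : ∀ i, (f i).IsHomogeneous (w i)) (D : ℕ)
    (p : MvPolynomial σ R) :
    homogeneousComponent D (aeval f p) = aeval f (weightedHomogeneousComponent w D p) := by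
  induction p using MvPolynomial.induction_on' with
  | monomial m c =>
    rw [homogeneousComponent_of_mem (isHomogeneous_aeval_monomial w hf m c),
      weightedHomogeneousComponent_of_mem (isWeightedHomogeneous_monomial w m c rfl)]
    split_ifs
    · rfl
    · rw [map_zero]
  | add p q hp hq => rw [map_add, map_add, map_add, map_add, hp, hq]

/-! ### Principal ideals of forms are homogeneous -/

/-- A form `P` divides every homogeneous component of each of its multiples `P · Q`. [folklore] -/
theorem dvd_homogeneousComponent_mul {τ R : Type*} [CommSemiring R] {P : MvPolynomial τ R}
    {k : ℕ} (hP : P.IsHomogeneous k) (Q : MvPolynomial τ R) (D : ℕ) :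
    P ∣ homogeneousComponent D (P * Q) := by
  classical
  rw [← sum_homogeneousComponent Q, Finset.mul_sum, map_sum]
  refine Finset.dvd_sum fun i _ => ?_
  rw [homogeneousComponent_of_mem (hP.mul (homogeneousComponent_isHomogeneous i Q))]
  split_ifs
  · exact dvd_mul_right P _
  · exact dvd_zero P

/-! ### The stub -/

/-- **Weighted components of relations are relations.** If `U, U'` are real forms of degrees
`e, e'` in the `n × n` matrix variables and `per_n ∣ R(U, U')`, then `per_n ∣ R_D(U, U')` for the
weight-`D` component `R_D` of `R` with respect to the weights `(e, e')`. [folklore] -/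
theorem stub_relationComponents (n e e' D : ℕ) (U U' : MvPolynomial (Fin n × Fin n) ℝ)
    (hU : U.IsHomogeneous e) (hU' : U'.IsHomogeneous e')
    (R : MvPolynomial (Fin 2) ℝ)
    (hdvd : perPoly (Fin n) ℝ ∣ MvPolynomial.aeval ![U, U'] R) :
    perPoly (Fin n) ℝ ∣ MvPolynomial.aeval ![U, U']
      (MvPolynomial.weightedHomogeneousComponent (![e, e'] : Fin 2 → ℕ) D R) := by
  have hper : (perPoly (Fin n) ℝ).IsHomogeneous n := by
    simpa using (perPoly_isHomogeneous (n := Fin n) (k := ℝ))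
  have hf : ∀ i, ((![U, U'] : Fin 2 → MvPolynomial (Fin n × Fin n) ℝ) i).IsHomogeneous
      ((![e, e'] : Fin 2 → ℕ) i) := by
    intro i
    fin_cases i
    · simpa using hU
    · simpa using hU'
  obtain ⟨Q, hQ⟩ := hdvd
  rw [← homogeneousComponent_aeval _ hf, hQ]
  exact dvd_homogeneousComponent_mul hper Q D

end Summit.ValiantsHypothesis.ValiantsHypothesis.Theorems.DivisionGap.PerCofactorDegreeReduction.RelationComponents

end
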